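import Summits.CriticalPhenomena.PercolationContinuityZ3.Theorems.PercNearOneGluingNoHeavyLowerTailSahiCTCRtThreeWindowThreeCheck
import HarnessLib

/-!
# `NoHeavyLowerTail` (crux stmt-CriticalPhenomena-4575), P3 lane: **ROW 1 (ONE DOUBLED POINT) OF `R_3 ∈ ℕ[s]` FOR EVERY `#σ ≥ 3`**

Support file (seat `prim-l12-p3`, gen 51; `--supports stmt-CriticalPhenomena-4575`; `--computational`: one `native_decide` (`checkAll₃ = true`) inside
`check3_sound`, which re-checks the enumeration of `…RtThreeWindowThreeCheck` so that the deciding theorem owns its computational axiom locally).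
Memo `run/shared/lean/prim/prim-l12/FROM-prim-l12-p3-g51-ROW0-ALL-K-LEAN.md` §5.

**THEOREM `coeff_ind_add_single_two_Rt_three_nonneg`.**  For up-sets `𝒳, 𝒵 ⊆ 2^α` with `∅ ∉ 𝒳, 𝒵`, a finset `σ` (`#σ ≥ 3`) whose points are loop-free in
both families, and `d ∉ σ` (a loop `{d}` IS allowed), `coeff_{1_σ + 2e_d} R_3(𝒳,𝒵) ≥ 0` — the rows with ONE doubled point of the open core `hLF` of
`…RtThreeDiagonalBase.coeff_Rt_three_nonneg_of_loopFree'`, for all supports with at least three single points (gen 50 proved them on paper with a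
74-atom polynomial LP family; here: Kleitman block form + a three-point window certificate by per-pair Taylor positivity, no LP family).
PROOF.  `…RtThreeRowOneWindow.coeff_rowOne_nonneg_of_local` asks for a local inequality on every 3-subset `Q ⊆ σ`; `exists_map_univ_eq_three` writes
`Q = univ.map φ`; `atomSum_map`, `pairSum_map` and the `pull_*` lemmas move the local quantity to the pulled-back trace data on `Fin 3`, which form admissible
sides (`pull_mem_sides_three`); `…WindowThreeSum/Poly` turn it into sixteen moments and a polynomial in `j = #σ − 5`, and `check3_sound` gives the signs
(Taylor coefficients at `5` for `#σ ≥ 6`, direct values for `#σ = 3, 4, 5`).  No new definitions; nothing is asserted about the crux.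
-/

namespace Summit.CriticalPhenomena.PercolationContinuityZ3.Theorems.SahiCTCForms

open Finset MvPolynomial SahiCTCGenFun

/-! ## Part ROW (row 1): transport to `Fin 3` and ROW 1 for every `#σ ≥ 3` -/

namespace RtThreeFin3

open SahiCTCGenFun

/-- A 3-subset is the image of `univ : Finset (Fin 3)` under an injection. [folklore] -/
theorem exists_map_univ_eq_three {α : Type*} [DecidableEq α] (Q : Finset α) (hQ : #Q = 3) :
    ∃ φ : Fin 3 ↪ α, (univ : Finset (Fin 3)).map φ = Q := by
  let e : Fin 3 ≃ {x // x ∈ Q} := (Fintype.equivFinOfCardEq (by rw [Fintype.card_coe, hQ])).symm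
  refine ⟨e.toEmbedding.trans (Function.Embedding.subtype _), ?_⟩
  ext x
  simp only [mem_map, mem_univ, true_and, Function.Embedding.trans_apply, Equiv.coe_toEmbedding, Function.Embedding.coe_subtype]
  constructor
  · rintro ⟨i, rfl⟩; exact (e i).2
  · intro hx; exact ⟨e.symm ⟨x, hx⟩, by simp⟩

section Pull
variable {α : Type*} [DecidableEq α] [Fintype α] (φ : Fin 3 ↪ α)

omit [Fintype α] in
/-- Transport of a localised pair sum along `φ : Fin 3 ↪ α`: the families pull back to `{T : T.map φ ∈ ·}`. [this work] -/
theorem pairSum_map (A B : Finset (Finset α)) (k : ℕ) :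
    ∑ P ∈ ((univ : Finset (Fin 3)).map φ).powerset, ∑ P' ∈ ((univ : Finset (Fin 3)).map φ).powerset,
        ιq A P * ιq B P' * (if Disjoint P P' then 1 else 0) / (((k - #(P ∪ P')).choose (3 - #(P ∪ P')) : ℕ) : ℚ) =
      ∑ P ∈ (univ : Finset (Fin 3)).powerset, ∑ P' ∈ (univ : Finset (Fin 3)).powerset,
        ιq ((univ : Finset (Fin 3)).powerset.filter fun T => T.map φ ∈ A) P *
          ιq ((univ : Finset (Fin 3)).powerset.filter fun T => T.map φ ∈ B) P' *
          (if Disjoint P P' then 1 else 0) / (((k - #(P ∪ P')).choose (3 - #(P ∪ P')) : ℕ) : ℚ) := by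
  rw [sum_powerset_map]
  refine sum_congr rfl fun P hP => ?_
  rw [sum_powerset_map]
  refine sum_congr rfl fun P' hP' => ?_
  have hd : (if Disjoint (P.map φ) (P'.map φ) then (1 : ℚ) else 0) = (if Disjoint P P' then 1 else 0) := by
    by_cases h : Disjoint P P'
    · rw [if_pos h, if_pos ((disjoint_map φ).2 h)]
    · rw [if_neg h, if_neg (fun h' => h ((disjoint_map φ).1 h'))]
  rw [ιq_map φ A (mem_powerset.1 hP), ιq_map φ B (mem_powerset.1 hP'), ← map_union, card_map, hd]

/-- The pull-back of `Θ_j` is `Θ_j`. [this work] -/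
theorem pull_bySize (j : ℕ) :
    ((univ : Finset (Fin 3)).powerset.filter fun T => T.map φ ∈ (bySize (· < j) : Finset (Finset α))) = (bySize (· < j) : Finset (Finset (Fin 3))) := by
  ext T; simp only [bySize, mem_filter, mem_powerset, subset_univ, true_and, card_map]

omit [Fintype α] in
/-- The pull-back of `K_{<j}` is `(pull-back of K)_{<j}`. [this work] -/
theorem pull_below (j : ℕ) (K : Finset (Finset α)) :
    ((univ : Finset (Fin 3)).powerset.filter fun T => T.map φ ∈ below j K) =
      below j ((univ : Finset (Fin 3)).powerset.filter fun T => T.map φ ∈ K) := by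
  ext T; simp only [below, mem_filter, mem_powerset, subset_univ, true_and, card_map]

omit [Fintype α] in
/-- The pull-back of an intersection. [this work] -/
theorem pull_inter (K L : Finset (Finset α)) :
    ((univ : Finset (Fin 3)).powerset.filter fun T => T.map φ ∈ K ∩ L) =
      ((univ : Finset (Fin 3)).powerset.filter fun T => T.map φ ∈ K) ∩ ((univ : Finset (Fin 3)).powerset.filter fun T => T.map φ ∈ L) := by
  ext T; simp only [mem_filter, mem_inter, mem_powerset, subset_univ, true_and]

omit [Fintype α] in
/-- The pull-back of `K ∖ (L ∪ L')`. [this work] -/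
theorem pull_sdiff_union (K L L' : Finset (Finset α)) :
    ((univ : Finset (Fin 3)).powerset.filter fun T => T.map φ ∈ K \ (L ∪ L')) =
      ((univ : Finset (Fin 3)).powerset.filter fun T => T.map φ ∈ K) \
        (((univ : Finset (Fin 3)).powerset.filter fun T => T.map φ ∈ L) ∪ ((univ : Finset (Fin 3)).powerset.filter fun T => T.map φ ∈ L')) := by
  ext T; simp only [mem_filter, mem_sdiff, mem_union, mem_powerset, subset_univ, true_and, not_or]

set_option maxRecDepth 16384 in
-- (membership in `sides₃` unfolds a large decidable predicate)
/-- The pulled-back trace data `(𝒳|_Q, link of 𝒳 at d|_Q)` of an up-set with `∅ ∉ 𝒳` and no singleton `{φ i} ∈ 𝒳` (`d` outside the image) is an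
admissible side. [this work] -/
theorem pull_mem_sides_three {F : Finset (Finset α)} (hF : IsUpperSet (F : Set (Finset α))) {d : α} (hd : ∀ i : Fin 3, φ i ≠ d) (h0 : ∅ ∉ F)
    (h1 : ∀ i : Fin 3, ({φ i} : Finset α) ∉ F) :
    (((univ : Finset (Fin 3)).powerset.filter fun T => T.map φ ∈ delV d F),
      ((univ : Finset (Fin 3)).powerset.filter fun T => T.map φ ∈ linkV d F)) ∈ sides₃ := by
  have hnd : ∀ T : Finset (Fin 3), d ∉ T.map φ := fun T hT => by
    obtain ⟨i, _, hi⟩ := mem_map.1 hT; exact hd i hi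
  refine mem_sides₃ (fun S hS T hST => ?_) (fun S hS T hST => ?_) (fun S hS => ?_) (fun S hS => ?_)
  · have hSF : S.map φ ∈ F := ((mem_delV_iff_of_not_mem (hnd S)).1 (mem_filter.1 hS).2)
    exact mem_filter.2 ⟨mem_powerset.2 (subset_univ _), (mem_delV_iff_of_not_mem (hnd T)).2 (hF (map_subset_map.2 hST) hSF)⟩
  · have hSF := (mem_linkV_iff_of_not_mem (hnd S)).1 (mem_filter.1 hS).2
    rw [mem_filter] at hSF
    refine mem_filter.2 ⟨mem_powerset.2 (subset_univ _), (mem_linkV_iff_of_not_mem (hnd T)).2 (mem_filter.2 ⟨mem_powerset.2 (subset_univ _), ?_⟩)⟩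
    exact hF (insert_subset_insert d (map_subset_map.2 hST)) hSF.2
  · exact mem_filter.2 ⟨mem_powerset.2 (subset_univ _), delV_subset_linkV_of_isUpperSet hF (mem_filter.1 hS).2⟩
  · have hSF : S.map φ ∈ F := ((mem_delV_iff_of_not_mem (hnd S)).1 (mem_filter.1 hS).2)
    by_contra hlt
    rcases Nat.lt_or_ge #S 1 with hS0 | hS1
    · rw [card_eq_zero.1 (show #S = 0 by omega), map_empty] at hSF; exact h0 hSF
    · obtain ⟨i, hi⟩ := card_eq_one.1 (show #S = 1 by omega)
      rw [hi, map_singleton] at hSF; exact h1 i hSF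

end Pull

set_option maxRecDepth 16384 in
-- (membership in `sides₃` unfolds a large decidable predicate)
/-- **THE FINITE CHECK, SOUND FORM** (one `native_decide`: `checkAll₃ = true`): for a pair of admissible sides the eight Taylor forms at `5` and the direct
values at `k = 3, 4, 5` of the coded moments are `≥ 0`.  (Same content as `…WindowThreeCheck.checkPair₃_of_mem` + `nonneg_of_checkPair₃`; re-checked here so
that the deciding theorem below owns its computational axiom under an ASCII name.) [this work] -/
theorem check3_sound {X0 X1 Z0 Z1 : Finset (Finset (Fin 3))} (hX : (X0, X1) ∈ sides₃) (hZ : (Z0, Z1) ∈ sides₃) :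
    (∀ i, i < 8 → 0 ≤ lin₃ i ((CL3l.map fun c => atomsK₃ c.1 c.2).map fun t => momJc₃ t (encF₃ X1) (encF₃ Z1))
        ((CL3l.map fun c => atomsK₃ c.1 c.2).map fun t => momJc₃ t (encF₃ X0) (encF₃ Z1) + momJc₃ t (encF₃ X1) (encF₃ Z0))
        (((List.range 4).map fun m => pairsK₃ m).map fun t => momWc t (encF₃ X0) (encF₃ X1) (encF₃ Z0) (encF₃ Z1)))
    ∧ (∀ k, k = 3 ∨ k = 4 ∨ k = 5 → 0 ≤ direct₃ k ((CL3l.map fun c => atomsK₃ c.1 c.2).map fun t => momJc₃ t (encF₃ X1) (encF₃ Z1))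
        ((CL3l.map fun c => atomsK₃ c.1 c.2).map fun t => momJc₃ t (encF₃ X0) (encF₃ Z1) + momJc₃ t (encF₃ X1) (encF₃ Z0))
        (((List.range 4).map fun m => pairsK₃ m).map fun t => momWc t (encF₃ X0) (encF₃ X1) (encF₃ Z0) (encF₃ Z1))) := by
  have h : checkAll₃ = true := by native_decide
  unfold checkAll₃ at h
  dsimp only at h
  have h' := of_decide_eq_true h
  have hx : (encF₃ X0, encF₃ X1) ∈ sides₃.image (fun p => (encF₃ p.1, encF₃ p.2)) := mem_image.2 ⟨(X0, X1), hX, rfl⟩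
  have hz : (encF₃ Z0, encF₃ Z1) ∈ sides₃.image (fun p => (encF₃ p.1, encF₃ p.2)) := mem_image.2 ⟨(Z0, Z1), hZ, rfl⟩
  exact nonneg_of_checkPair₃ (h' (encF₃ X0, encF₃ X1) hx (encF₃ Z0, encF₃ Z1) hz)

set_option maxRecDepth 16384 in
-- (the local quantity is a large term; the default recursion depth does not suffice to elaborate the transport rewrites)
/-- **ROW 1 (ONE DOUBLED POINT) OF `R_3 ∈ ℕ[s]` FOR EVERY `#σ ≥ 3`**: for up-sets `𝒳, 𝒵` with `∅ ∉ 𝒳, 𝒵`, a finset `σ` of single points that are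
loop-free in both families, and a doubled point `d ∉ σ`, `coeff_{1_σ + 2e_d} R_3(𝒳,𝒵) ≥ 0`.  (Rows `#dbl = 1` of the open core `hLF` of
`coeff_Rt_three_nonneg_of_loopFree'`, except the supports with `#σ ≤ 2`; loops at `d` ARE allowed.) [this work] -/
theorem coeff_ind_add_single_two_Rt_three_nonneg {α : Type*} [DecidableEq α] [Fintype α] {F G : Finset (Finset α)}
    (hF : IsUpperSet (F : Set (Finset α))) (hG : IsUpperSet (G : Set (Finset α))) {σ : Finset α} {d : α} (hd : d ∉ σ) (hσ : 3 ≤ #σ)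
    (h0F : ∅ ∉ F) (h0G : ∅ ∉ G) (h1F : ∀ v ∈ σ, ({v} : Finset α) ∉ F) (h1G : ∀ v ∈ σ, ({v} : Finset α) ∉ G) :
    0 ≤ (Rt 3 F G).coeff (ind σ + Finsupp.single d 2) := by
  refine coeff_rowOne_nonneg_of_local hF hG hd hσ fun Q hQ => ?_
  obtain ⟨hQσ, hQ3⟩ := mem_powersetCard.1 hQ
  obtain ⟨φ, rfl⟩ := exists_map_univ_eq_three Q hQ3
  have hφσ : ∀ i : Fin 3, φ i ∈ σ := fun i => hQσ (mem_map_of_mem φ (mem_univ i))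
  have hφd : ∀ i : Fin 3, φ i ≠ d := fun i h => hd (h ▸ hφσ i)
  have hsX := pull_mem_sides_three φ hF hφd h0F (fun i => h1F _ (hφσ i))
  have hsZ := pull_mem_sides_three φ hG hφd h0G (fun i => h1G _ (hφσ i))
  -- the local inequality on `Fin 3` for the pulled-back trace data (as `…WindowThreeCheck.loc_nonneg_fin3`, from the locally owned check)
  have key : ∀ (X0 X1 Z0 Z1 : Finset (Finset (Fin 3))), (X0, X1) ∈ sides₃ → (Z0, Z1) ∈ sides₃ →
      0 ≤ ∑ c ∈ CL3l.toFinset, WlocT 3 #σ c.1 c.2 * momJ₃ c.1 c.2 X1 Z1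
        + ∑ c ∈ CL3l.toFinset, WlocT 2 #σ c.1 c.2 * (momJ₃ c.1 c.2 X0 Z1 + momJ₃ c.1 c.2 X1 Z0)
        + ∑ m ∈ range 4, (1 / ((((#σ - m).choose (3 - m)) : ℕ) : ℚ)) * momW m X0 X1 Z0 Z1 := by
    intro X0 X1 Z0 Z1 hX hZ
    obtain ⟨hlin, hdir⟩ := check3_sound hX hZ
    by_cases h6 : 6 ≤ #σ
    · obtain ⟨j, hj⟩ : ∃ j, #σ = j + 5 := ⟨#σ - 5, by omega⟩
      rw [hj]
      have hD : 0 < Dfac₅ j := by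
        unfold Dfac₅
        have : (1 : ℚ) ≤ j := by exact_mod_cast (show 1 ≤ j by omega)
        positivity
      refine (mul_nonneg_iff_of_pos_left hD).1 ?_
      rw [loc_poly₃ j (fun t s => momJ₃ t s X1 Z1) (fun t s => momJ₃ t s X0 Z1 + momJ₃ t s X1 Z0) (fun m => momW m X0 X1 Z0 Z1)]
      refine sum_nonneg fun i hi => mul_nonneg ?_ (by positivity)
      have h := hlin i (mem_range.1 hi)
      rw [lin₃_eq] at h
      simp only [momJc₃_encF₃, momWc_encF₃] at h
      exact h
    · have h := hdir (#σ) (by omega)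
      rw [direct₃_eq] at h
      simp only [momJc₃_encF₃, momWc_encF₃] at h
      exact h
  have key' := key _ _ _ _ hsX hsZ
  rw [atomSum_map, atomSum_map, atomSum_map]
  rw [pairSum_map, pairSum_map, pairSum_map, pairSum_map, pairSum_map, pairSum_map, pairSum_map]
  rw [pull_bySize, pull_bySize, pull_below, pull_below, pull_below, pull_below, pull_below, pull_below, pull_below, pull_inter, pull_inter,
    pull_sdiff_union, pull_inter]
  rw [atomSum_local₃_eq, atomSum_local₃_eq, atomSum_local₃_eq]
  have hp := pairs_local₃_eq (#σ) ((univ : Finset (Fin 3)).powerset.filter fun T => T.map φ ∈ delV d F)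
    ((univ : Finset (Fin 3)).powerset.filter fun T => T.map φ ∈ linkV d F) ((univ : Finset (Fin 3)).powerset.filter fun T => T.map φ ∈ delV d G)
    ((univ : Finset (Fin 3)).powerset.filter fun T => T.map φ ∈ linkV d G)
  have hcomb : ∑ c ∈ CL3l.toFinset, WlocT 2 #σ c.1 c.2 * momJ₃ c.1 c.2
        ((univ : Finset (Fin 3)).powerset.filter fun T => T.map φ ∈ delV d F) ((univ : Finset (Fin 3)).powerset.filter fun T => T.map φ ∈ linkV d G)
      + ∑ c ∈ CL3l.toFinset, WlocT 2 #σ c.1 c.2 * momJ₃ c.1 c.2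
        ((univ : Finset (Fin 3)).powerset.filter fun T => T.map φ ∈ linkV d F) ((univ : Finset (Fin 3)).powerset.filter fun T => T.map φ ∈ delV d G) =
      ∑ c ∈ CL3l.toFinset, WlocT 2 #σ c.1 c.2 * (momJ₃ c.1 c.2
        ((univ : Finset (Fin 3)).powerset.filter fun T => T.map φ ∈ delV d F) ((univ : Finset (Fin 3)).powerset.filter fun T => T.map φ ∈ linkV d G)
        + momJ₃ c.1 c.2
        ((univ : Finset (Fin 3)).powerset.filter fun T => T.map φ ∈ linkV d F) ((univ : Finset (Fin 3)).powerset.filter fun T => T.map φ ∈ delV d G)) := by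
    rw [← sum_add_distrib]; exact sum_congr rfl fun c _ => by ring
  linarith [key', hcomb, hp]

end RtThreeFin3

end Summit.CriticalPhenomena.PercolationContinuityZ3.Theorems.SahiCTCForms
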